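import Literature.MathematicalPhysics.QuantumManyBody.TorusGalerkinScattering
import Mathlib.Analysis.SpecialFunctions.Trigonometric.Bounds
import HarnessLib

/-!
# The pair coefficients `W_L(a) = ∫v e_a`: uniform bound, Lipschitz bound, and the Galerkin `ĝ_p`

Topic `Literature/MathematicalPhysics/QuantumManyBody`, namespace `BoseGas`; theorem-only, for the
provefact `Literature.MathematicalPhysics.QuantumManyBody.BoseGas.BastiCenatiempoSchlein2021_upperBound`
(inputs of §5 of [BastiCenatiempoSchlein2021]: "`|ĝ_p - ĝ_0| ≤ C|p|N^{2κ-1}`" on p. 19 and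
`|V̂| ≤ ∫V`).

* `norm_potFT_le` — `|W_L(a)| ≤ ∫v`;
* `norm_cellWave_sub_one_le` — `|e_a(z) - 1| ≤ ‖k_a‖‖z‖` (`k_a = 2πa/L`);
* `norm_integral_pot_mul_sub_one_mul_le` — `|∫ v(e_a - 1)h| ≤ ‖k_a‖R₀∫v|h|` when `v = 0` beyond `R₀`;
* `sum_mul_potFT_eq_integral`, `gHat_eq_re_integral` — `∑_q c_qW_L(p - q) = ∫ v e_p conj(w̃)`,
  `ĝ_p = Re∫v e_p(1 - conj w̃)` with `w̃ = ∑_qc_qe_q`;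
* `integral_pot_mul_normSq_one_sub_eq` — `∫v|1 - w̃|² = Q(c)` (the potential form `galerkinPot`);
* `abs_gHat_sub_gHat_le` — **`|ĝ_p - ĝ_0| ≤ ‖k_p‖R₀(∫v + Q(c))/2`**.

## References

* [BastiCenatiempoSchlein2021] G. Basti, S. Cenatiempo, B. Schlein, Forum Math. Sigma 9 (2021) e74,
  arXiv:2101.06222: Lemma 2.2, §5.1 (p. 19).
-/

noncomputable section

namespace Literature.MathematicalPhysics.QuantumManyBody.BoseGas

open MeasureTheory Complex Finset
open scoped ENNReal ComplexConjugate BigOperators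

variable {v : ℝ → ℝ≥0∞} {L : ℝ}

/-! ### Uniform and Lipschitz bounds for `W_L` -/

/-- **`|W_L(a)| ≤ ∫v`.** [folklore] -/
theorem norm_potFT_le (v : ℝ → ℝ≥0∞) (L : ℝ) (a : Momentum) :
    ‖potFT v L a‖ ≤ ∫ z : Space, (v ‖z‖).toReal := by
  unfold potFT
  refine (norm_integral_le_integral_norm _).trans (le_of_eq ?_)
  refine integral_congr_ae (Filter.Eventually.of_forall fun z => ?_)
  simp only [norm_mul, Complex.norm_real, Real.norm_eq_abs, norm_cellWave, mul_one,
    abs_of_nonneg ENNReal.toReal_nonneg]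

/-- `W_L(0) = ∫v`. [folklore] -/
theorem potFT_zero (v : ℝ → ℝ≥0∞) (L : ℝ) : potFT v L 0 = ((∫ z : Space, (v ‖z‖).toReal : ℝ) : ℂ) := by
  unfold potFT
  simp only [cellWave_zero, mul_one]
  exact integral_complex_ofReal

/-- **`|e_a(z) - 1| ≤ ‖k_a‖‖z‖`** (`k_a = 2πa/L`, `|e^{iθ} - 1| ≤ |θ|` and Cauchy–Schwarz). [folklore] -/
theorem norm_cellWave_sub_one_le (L : ℝ) (a : Momentum) (z : Space) :
    ‖cellWave L a z - 1‖ ≤ ‖waveVector L a‖ * ‖z‖ := by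
  rw [cellWave_apply]
  have hθ : (2 * Real.pi * Complex.I * ((∑ k, (a k : ℝ) * z k : ℝ) : ℂ) / (L : ℂ)) =
      Complex.I * ((2 * Real.pi * (∑ k, (a k : ℝ) * z k) / L : ℝ) : ℂ) := by push_cast; ring
  rw [hθ]
  refine le_trans Real.norm_exp_I_mul_ofReal_sub_one_le ?_
  have hinner : 2 * Real.pi * (∑ k, (a k : ℝ) * z k) / L = inner ℝ (waveVector L a) z := by
    rw [PiLp.inner_apply]
    simp only [waveVector_apply, RCLike.inner_apply, conj_trivial]
    rw [Finset.mul_sum, Finset.sum_div]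
    exact Finset.sum_congr rfl fun k _ => by ring
  rw [hinner, Real.norm_eq_abs]
  exact abs_real_inner_le_norm _ _

/-- **Lipschitz bound**: if `v(r) = 0` for `r > R₀` (`R₀ ≥ 0`) and `v|h|` is integrable, then
`|∫ v(|z|)(e_a(z) - 1)h(z) dz| ≤ ‖k_a‖R₀ ∫ v|h|`. [cite: BastiCenatiempoSchlein2021, §5.1 (p. 19,
"`|ĝ_p - ĝ_0| ≤ C|p|N^{2κ-1}`", mechanism)] -/
theorem norm_integral_pot_mul_sub_one_mul_le {R₀ : ℝ} (hsupp : ∀ r, R₀ < r → v r = 0)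
    (L : ℝ) (a : Momentum) {h : Space → ℂ}
    (hint : Integrable fun z : Space => (v ‖z‖).toReal * ‖h z‖) :
    ‖∫ z : Space, ((v ‖z‖).toReal : ℂ) * (cellWave L a z - 1) * h z‖ ≤
      ‖waveVector L a‖ * R₀ * ∫ z : Space, (v ‖z‖).toReal * ‖h z‖ := by
  rw [← integral_const_mul]
  refine norm_integral_le_of_norm_le (hint.const_mul _) (Filter.Eventually.of_forall fun z => ?_)
  rw [norm_mul, norm_mul, Complex.norm_real, Real.norm_eq_abs, abs_of_nonneg ENNReal.toReal_nonneg]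
  by_cases hz : ‖z‖ ≤ R₀
  · have h1 := norm_cellWave_sub_one_le L a z
    have h2 : ‖cellWave L a z - 1‖ ≤ ‖waveVector L a‖ * R₀ :=
      h1.trans (mul_le_mul_of_nonneg_left hz (norm_nonneg _))
    have hv0 : 0 ≤ (v ‖z‖).toReal := ENNReal.toReal_nonneg
    calc (v ‖z‖).toReal * ‖cellWave L a z - 1‖ * ‖h z‖ ≤ (v ‖z‖).toReal * (‖waveVector L a‖ * R₀) * ‖h z‖ := by
          gcongr
      _ = ‖waveVector L a‖ * R₀ * ((v ‖z‖).toReal * ‖h z‖) := by ring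
  · rw [hsupp _ (lt_of_not_ge hz)]
    simp

/-! ### The Galerkin right side `ĝ_p` as an integral -/

section Galerkin

variable {ι : Type*} [Fintype ι]

omit [Fintype ι] in
/-- `|w̃(z)| ≤ ∑|c_q|`. [folklore] -/
theorem norm_bandFun_le [Fintype ι] (L : ℝ) (e : ι → Momentum) (c : ι → ℝ) (z : Space) :
    ‖∑ q, (c q : ℂ) * cellWave L (e q) z‖ ≤ ∑ q, |c q| := by
  refine (norm_sum_le _ _).trans (le_of_eq (Finset.sum_congr rfl fun q _ => ?_))
  rw [norm_mul, Complex.norm_real, norm_cellWave, mul_one, Real.norm_eq_abs]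

/-- `w̃` is continuous. [folklore] -/
theorem continuous_bandFun (L : ℝ) (e : ι → Momentum) (c : ι → ℝ) :
    Continuous fun z : Space => ∑ q, (c q : ℂ) * cellWave L (e q) z :=
  continuous_finsetSum _ fun q _ => continuous_const.mul (continuous_cellWave L (e q))

/-- **`∑_q c_q W_L(p - e q) = ∫ v(|z|) e_p(z) conj(w̃(z)) dz`** for real `c`. [folklore] -/
theorem sum_mul_potFT_eq_integral (hv : Measurable v) (hint : (∫⁻ z : Space, v ‖z‖) ≠ ⊤) (L : ℝ)
    (e : ι → Momentum) (c : ι → ℝ) (p : Momentum) :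
    ∑ q, (c q : ℂ) * potFT v L (p - e q) =
      ∫ z : Space, ((v ‖z‖).toReal : ℂ) * cellWave L p z * conj (∑ q, (c q : ℂ) * cellWave L (e q) z) := by
  have hint' : ∀ q, Integrable (fun z : Space => ((v ‖z‖).toReal : ℂ) * ((c q : ℂ) * cellWave L (p - e q) z)) := by
    intro q
    have := (integrable_pot_mul_cellWave hv hint L (p - e q)).const_mul (c q : ℂ)
    refine this.congr (Filter.Eventually.of_forall fun z => ?_)
    simp only; ring
  have hpt : ∀ z : Space, ((v ‖z‖).toReal : ℂ) * cellWave L p z * conj (∑ q, (c q : ℂ) * cellWave L (e q) z) =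
      ∑ q, ((v ‖z‖).toReal : ℂ) * ((c q : ℂ) * cellWave L (p - e q) z) := by
    intro z
    rw [map_sum, Finset.mul_sum]
    refine Finset.sum_congr rfl fun q _ => ?_
    rw [map_mul, Complex.conj_ofReal, conj_cellWave, sub_eq_add_neg, cellWave_add_index]
    ring
  simp_rw [hpt]
  rw [integral_finsetSum _ fun q _ => hint' q]
  refine Finset.sum_congr rfl fun q _ => ?_
  unfold potFT
  rw [← integral_const_mul]
  refine integral_congr_ae (Filter.Eventually.of_forall fun z => ?_)
  simp only; ring

/-- **`ĝ_p = Re ∫ v e_p (1 - conj w̃)`**: the right side of the Galerkin scattering equation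
(`ĝ_p = Re W_L(p) - ∑_q Re W_L(p - e q) c_q`) as an integral. [folklore] -/
theorem gHat_eq_re_integral (hv : Measurable v) (hint : (∫⁻ z : Space, v ‖z‖) ≠ ⊤) (L : ℝ)
    (e : ι → Momentum) (c : ι → ℝ) (p : Momentum) :
    (potFT v L p).re - ∑ q, (potFT v L (p - e q)).re * c q =
      (∫ z : Space, ((v ‖z‖).toReal : ℂ) * cellWave L p z *
        (1 - conj (∑ q, (c q : ℂ) * cellWave L (e q) z))).re := by
  have h1 : ∑ q, (potFT v L (p - e q)).re * c q = (∑ q, (c q : ℂ) * potFT v L (p - e q)).re := by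
    rw [Complex.re_sum]
    exact Finset.sum_congr rfl fun q _ => by rw [Complex.re_ofReal_mul]; ring
  rw [h1, sum_mul_potFT_eq_integral hv hint L e c p, ← Complex.sub_re]
  congr 1
  unfold potFT
  rw [← integral_sub (integrable_pot_mul_cellWave hv hint L p)]
  · refine integral_congr_ae (Filter.Eventually.of_forall fun z => ?_)
    simp only; ring
  · refine ((integrable_pot_mul_cellWave hv hint L p)).mul_bdd (c := ∑ q, |c q|)
      (continuous_bandFun L e c).aestronglyMeasurable.star ?_  -- hmm conj measurability
    exact Filter.Eventually.of_forall fun z => by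
      rw [Complex.norm_conj]; exact norm_bandFun_le L e c z

/-- **`∫ v|1 - w̃|² = Q(c)`**: the potential form `galerkinPot e (Re W_L) c` is the `v`-weighted
`L²` distance of the band function from `1` (Bochner identity on the band with a zero slot).
[folklore] -/
theorem integral_pot_mul_normSq_one_sub_eq (hv : Measurable v) (hint : (∫⁻ z : Space, v ‖z‖) ≠ ⊤) (L : ℝ)
    (e : ι → Momentum) (c : ι → ℝ) :
    ∫ z : Space, (v ‖z‖).toReal * ‖1 - ∑ q, (c q : ℂ) * cellWave L (e q) z‖ ^ 2 =
      galerkinPot e (fun k => (potFT v L k).re) c := by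
  classical
  -- Bochner identity on `Option ι` with momenta `(0, e)` and coefficients `(1, -c)`
  have h := sum_sum_mul_mul_potFT hv hint L (fun a : Option ι => a.elim 0 e) (fun a => a.elim 1 (fun q => -c q))
  have hfun : ∀ z : Space, ∑ a : Option ι, ((Option.elim a 1 (fun q => -c q) : ℝ) : ℂ) * cellWave L (Option.elim a 0 e) z =
      1 - ∑ q, (c q : ℂ) * cellWave L (e q) z := by
    intro z
    rw [Fintype.sum_option]
    simp only [Option.elim, cellWave_zero, Complex.ofReal_one, mul_one, Complex.ofReal_neg, neg_mul,
      Finset.sum_neg_distrib, sub_eq_add_neg]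
  simp only [hfun] at h
  have hR : (∫ z : Space, ((v ‖z‖).toReal : ℂ) * (((‖1 - ∑ q, (c q : ℂ) * cellWave L (e q) z‖ ^ 2 : ℝ)) : ℂ)) =
      ((∫ z : Space, (v ‖z‖).toReal * ‖1 - ∑ q, (c q : ℂ) * cellWave L (e q) z‖ ^ 2 : ℝ) : ℂ) := by
    rw [← integral_complex_ofReal]
    refine integral_congr_ae (Filter.Eventually.of_forall fun z => ?_)
    push_cast; ring
  have hre := congrArg Complex.re h
  rw [hR, Complex.ofReal_re] at hre
  rw [← hre]
  -- evaluate the real part of the left side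
  have hL : (∑ a : Option ι, ∑ b : Option ι, ((Option.elim a 1 (fun q => -c q) : ℝ) : ℂ) *
      ((Option.elim b 1 (fun q => -c q) : ℝ) : ℂ) * potFT v L (Option.elim a 0 e - Option.elim b 0 e)).re =
      ∑ a : Option ι, ∑ b : Option ι, (Option.elim a 1 (fun q => -c q)) * (Option.elim b 1 (fun q => -c q)) *
        (potFT v L (Option.elim a 0 e - Option.elim b 0 e)).re := by
    rw [Complex.re_sum]
    refine Finset.sum_congr rfl fun a _ => ?_
    rw [Complex.re_sum]
    refine Finset.sum_congr rfl fun b _ => ?_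
    rw [← Complex.ofReal_mul, Complex.re_ofReal_mul]
  rw [hL, Fintype.sum_option]
  simp only [Fintype.sum_option, Option.elim]
  have e1 : ∑ b, (1 : ℝ) * -c b * (potFT v L (0 - e b)).re = -∑ q, (potFT v L (e q)).re * c q := by
    rw [← Finset.sum_neg_distrib]
    exact Finset.sum_congr rfl fun q _ => by rw [zero_sub, re_potFT_neg]; ring
  have e2 : ∑ a, (-c a * 1 * (potFT v L (e a - 0)).re + ∑ b, -c a * -c b * (potFT v L (e a - e b)).re) =
      -∑ q, (potFT v L (e q)).re * c q + ∑ p, ∑ q, (potFT v L (e p - e q)).re * c p * c q := by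
    rw [Finset.sum_add_distrib, ← Finset.sum_neg_distrib]
    congr 1
    · exact Finset.sum_congr rfl fun q _ => by rw [sub_zero]; ring
    · exact Finset.sum_congr rfl fun p _ => Finset.sum_congr rfl fun q _ => by ring
  rw [e1, e2, sub_self]
  unfold galerkinPot
  ring

/-- **`|ĝ_p - ĝ_0| ≤ ‖k_p‖R₀(∫v + Q(c))/2`** for a potential vanishing beyond `R₀`: the Lipschitz
bound `|e_p - 1| ≤ ‖k_p‖R₀` on the support and `∫v|1 - w̃| ≤ (∫v + ∫v|1 - w̃|²)/2`.
[cite: BastiCenatiempoSchlein2021, §5.1 (p. 19, "`|ĝ_p - ĝ_0| ≤ C|p|N^{2κ-1}`")] -/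
theorem abs_gHat_sub_gHat_le (hv : Measurable v) (hint : (∫⁻ z : Space, v ‖z‖) ≠ ⊤) {R₀ : ℝ} (hR₀ : 0 ≤ R₀)
    (hsupp : ∀ r, R₀ < r → v r = 0) (L : ℝ) (e : ι → Momentum) (c : ι → ℝ) (p : Momentum) :
    |((potFT v L p).re - ∑ q, (potFT v L (p - e q)).re * c q) -
        ((potFT v L 0).re - ∑ q, (potFT v L (0 - e q)).re * c q)| ≤
      ‖waveVector L p‖ * R₀ * (((∫ z : Space, (v ‖z‖).toReal) + galerkinPot e (fun k => (potFT v L k).re) c) / 2) := by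
  have hwb : ∀ z, ‖1 - conj (∑ q, (c q : ℂ) * cellWave L (e q) z)‖ ≤ 1 + ∑ q, |c q| := fun z => by
    refine (norm_sub_le _ _).trans ?_
    rw [norm_one, Complex.norm_conj]; exact add_le_add le_rfl (norm_bandFun_le L e c z)
  have hmeas : AEStronglyMeasurable (fun z : Space => 1 - conj (∑ q, (c q : ℂ) * cellWave L (e q) z)) volume :=
    (continuous_const.sub ((continuous_bandFun L e c).star)).aestronglyMeasurable
  have hI : Integrable fun z : Space => (v ‖z‖).toReal * ‖1 - conj (∑ q, (c q : ℂ) * cellWave L (e q) z)‖ := by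
    refine ((integrable_pot_toReal hv hint)).mul_bdd (c := 1 + ∑ q, |c q|) hmeas.norm
      (Filter.Eventually.of_forall fun z => ?_)
    rw [Real.norm_eq_abs, abs_of_nonneg (norm_nonneg _)]; exact hwb z
  rw [gHat_eq_re_integral hv hint L e c p, gHat_eq_re_integral hv hint L e c 0, ← Complex.sub_re]
  refine (Complex.abs_re_le_norm _).trans ?_
  rw [← integral_sub]
  rotate_left
  · exact ((integrable_pot_mul_cellWave hv hint L p)).mul_bdd (c := 1 + ∑ q, |c q|) hmeas
      (Filter.Eventually.of_forall fun z => hwb z)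
  · exact ((integrable_pot_mul_cellWave hv hint L 0)).mul_bdd (c := 1 + ∑ q, |c q|) hmeas
      (Filter.Eventually.of_forall fun z => hwb z)
  have hpt : ∀ z : Space, ((v ‖z‖).toReal : ℂ) * cellWave L p z * (1 - conj (∑ q, (c q : ℂ) * cellWave L (e q) z)) -
      ((v ‖z‖).toReal : ℂ) * cellWave L 0 z * (1 - conj (∑ q, (c q : ℂ) * cellWave L (e q) z)) =
      ((v ‖z‖).toReal : ℂ) * (cellWave L p z - 1) * (1 - conj (∑ q, (c q : ℂ) * cellWave L (e q) z)) := fun z => by rw [cellWave_zero]; ring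
  simp only [hpt]
  refine (norm_integral_pot_mul_sub_one_mul_le hsupp L p hI).trans ?_
  refine mul_le_mul_of_nonneg_left ?_ (mul_nonneg (norm_nonneg _) hR₀)
  -- `∫ v|1 - conj w| ≤ (∫v + ∫v|1 - w|²)/2`
  rw [← integral_pot_mul_normSq_one_sub_eq hv hint L e c]
  have hI2 : Integrable fun z : Space => (v ‖z‖).toReal * ‖1 - ∑ q, (c q : ℂ) * cellWave L (e q) z‖ ^ 2 := by
    refine ((integrable_pot_toReal hv hint)).mul_bdd (c := (1 + ∑ q, |c q|) ^ 2)
      ((continuous_const.sub (continuous_bandFun L e c)).norm.pow 2).aestronglyMeasurable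
      (Filter.Eventually.of_forall fun z => ?_)
    rw [Real.norm_eq_abs, abs_of_nonneg (sq_nonneg _)]
    have h1 : ‖1 - ∑ q, (c q : ℂ) * cellWave L (e q) z‖ ≤ 1 + ∑ q, |c q| := by
      refine (norm_sub_le _ _).trans ?_; rw [norm_one]; exact add_le_add le_rfl (norm_bandFun_le L e c z)
    exact pow_le_pow_left₀ (norm_nonneg _) h1 2
  rw [← integral_add (integrable_pot_toReal hv hint) hI2, le_div_iff₀ (by norm_num : (0 : ℝ) < 2), ← integral_mul_const]
  refine integral_mono (hI.mul_const 2) ((integrable_pot_toReal hv hint).add hI2) fun z => ?_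
  have hv0 : 0 ≤ (v ‖z‖).toReal := ENNReal.toReal_nonneg
  have hn : ‖1 - conj (∑ q, (c q : ℂ) * cellWave L (e q) z)‖ = ‖1 - ∑ q, (c q : ℂ) * cellWave L (e q) z‖ := by
    rw [← Complex.norm_conj, map_sub, map_one, Complex.conj_conj]
  rw [hn]
  nlinarith [sq_nonneg (‖1 - ∑ q, (c q : ℂ) * cellWave L (e q) z‖ - 1), norm_nonneg (1 - ∑ q, (c q : ℂ) * cellWave L (e q) z)]

end Galerkin

end Literature.MathematicalPhysics.QuantumManyBody.BoseGas

end
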